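import Mathlib
import Literature.AlgebraicGeometry.Resolution.PointBlowupPolygonLaws
import Literature.AlgebraicGeometry.Resolution.PolygonSymmetry
import HarnessLib

/-!
# The polygon at the origin of the `u₂`-chart: `α″ = α`, `β″ ≤ α + β − 1`

Topic: `Literature/AlgebraicGeometry/Resolution`. Cossart–Jannsen–Saito, LNM 2270,
Lemma 12.2 (3): at the origin `x″` of the `u₂`-chart of the blowing up of the closed point
(parameters `(y″ = y/u₂, u″₁ = u₁/u₂, u₂)`), the weak transform `J″ = (J R″ : u₂^μ)` of an
idealistic exponent `(J, μ)` with `δ(J) > 1` has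

  `α(J″) = α(J)`,  `β(J″) ≤ α(J) + β(J) − 1`

(the map `Φ(a₁, a₂) = (a₁, a₁ + a₂ − 1)`; Cossart–Piltant 2008, proof of Lemma 4.5, p. 12, the
point `x′₁`: "`β(E′; u₁/u₂, u₂; z/u₂) ≤ α + β − 1`", whence `β″ < β` when `α < 1` by (16)).
PROVED by the `u₁ ↔ u₂` symmetry (`PolygonSymmetry`): the `u₂`-chart of `c` is the `u₁`-chart
of `c ∘ σ`, and `α, β` of `c″` are `ε, ζ` of `c″ ∘ σ` (`PointBlowupPolygonLaws.epsS_colon_eq`,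
`zetaS_colon_add_le`). No facts.

## Sources

* V. Cossart, U. Jannsen, S. Saito, LNM 2270 (2020), Lemma 12.2 (3). [CossartJannsenSaito2020]
* V. Cossart, O. Piltant, J. Algebra 320 (2008), proof of Lemma 4.5, p. 12, (16). [CossartPiltant2008]
-/

noncomputable section

open IsLocalRing MvPolynomial

namespace Literature.AlgebraicGeometry.Resolution

universe u

section ChartTwo

variable {R R' : Type u} [CommRing R] [CommRing R'] (φ : R →+* R') {c : Fin 3 → R}
  {c' : Fin 3 → R'} (h₂ : c' 2 = φ (c 2)) (h₀ : φ (c 0) = φ (c 2) * c' 0)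
  (h₁ : φ (c 1) = φ (c 2) * c' 1) {J : Ideal R} {μ : ℕ}

local notation "J''" => Submodule.colon (Ideal.map φ J) ({φ (c 2) ^ μ} : Set R')

include h₂ in
/-- Chart-two relations are chart-one relations for `c ∘ σ`. [folklore] -/
theorem chartTwo_h₁ : (c' ∘ σ₁₂) 1 = φ ((c ∘ σ₁₂) 1) := by simpa using h₂

include h₀ in
/-- Chart-two relations are chart-one relations for `c ∘ σ`. [folklore] -/
theorem chartTwo_h₀ : φ ((c ∘ σ₁₂) 0) = φ ((c ∘ σ₁₂) 1) * (c' ∘ σ₁₂) 0 := by simpa using h₀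

include h₁ in
/-- Chart-two relations are chart-one relations for `c ∘ σ`. [folklore] -/
theorem chartTwo_h₂ : φ ((c ∘ σ₁₂) 2) = φ ((c ∘ σ₁₂) 1) * (c' ∘ σ₁₂) 2 := by simpa using h₁

/-- Generation of `𝔪` by `c ∘ σ`. [folklore] -/
theorem chartTwo_hgen [IsLocalRing R] (hgen : Ideal.span {c 0, c 1, c 2} = maximalIdeal R) :
    Ideal.span {(c ∘ σ₁₂) 0, (c ∘ σ₁₂) 1, (c ∘ σ₁₂) 2} = maximalIdeal R := by
  rw [span_triple_comp_σ₁₂]; exact hgen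

/-- Generation of `𝔪′` by `c′ ∘ σ`. [folklore] -/
theorem chartTwo_hgen' [IsLocalRing R'] (hgen' : Ideal.span {c' 0, c' 1, c' 2} = maximalIdeal R') :
    Ideal.span {(c' ∘ σ₁₂) 0, (c' ∘ σ₁₂) 1, (c' ∘ σ₁₂) 2} = maximalIdeal R' := by
  rw [span_triple_comp_σ₁₂]; exact hgen'

/-- The weak transform in the `u₂`-chart is the colon ideal for `(φ ((c ∘ σ) 1))^μ`. [folklore] -/
theorem colon_comp_σ₁₂ :
    (Ideal.map φ J).colon {φ ((c ∘ σ₁₂) 1) ^ μ} = J'' := by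
  simp

variable [IsRegularLocalRing R] [IsRegularLocalRing R']
  (hgen : Ideal.span {c 0, c 1, c 2} = maximalIdeal R) (hdim : ringKrullDim R = 3)
  (hgen' : Ideal.span {c' 0, c' 1, c' 2} = maximalIdeal R') (hdim' : ringKrullDim R' = 3)

include h₂ h₀ h₁ hgen hdim hgen' hdim' in
/-- **CJS Lemma 12.2 (3), first law: `α(J″) = α(J)`** at the origin of the `u₂`-chart
(`J ⊆ 𝔪^μ`, `δ(J) > 1`). [cite: CossartJannsenSaito2020, Lemma 12.2 (3)] -/
theorem alphaS_colon_two_eq (hJμ : J ≤ maximalIdeal R ^ μ) (hne : (pts c J μ).Nonempty)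
    (hδ : μ.factorial < deltaS c J μ) : alphaS c' J'' μ = alphaS c J μ := by
  have hne' : (pts (c ∘ σ₁₂) J μ).Nonempty := (pts_comp_σ₁₂_nonempty_iff c J μ).mpr hne
  have hδ' : μ.factorial < deltaS (c ∘ σ₁₂) J μ := by rwa [deltaS_comp_σ₁₂]
  have key := epsS_colon_eq φ (chartTwo_h₁ φ h₂) (chartTwo_h₀ φ h₀) (chartTwo_h₂ φ h₁)
    (chartTwo_hgen hgen) hdim (chartTwo_hgen' hgen') hdim' hJμ hne' hδ'
  rw [colon_comp_σ₁₂, epsS_comp_σ₁₂, epsS_comp_σ₁₂] at key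
  exact key

include h₂ h₀ h₁ hgen hdim hgen' hdim' in
/-- **CJS Lemma 12.2 (3), second law: `β(J″) ≤ α(J) + β(J) − 1`** at the origin of the
`u₂`-chart (scaled: `βs″ + L ≤ αs + βs`); with `α < 1` (CoP1 (16), `x` isolated in `Σ`) this is
the strict drop `β(x′₁) < β(x)` of Cossart–Piltant Lemma 4.5 (2).
[cite: CossartJannsenSaito2020, Lemma 12.2 (3)] [cite: CossartPiltant2008, Lemma 4.5 (2), p. 12] -/
theorem betaS_colon_two_add_le (hJμ : J ≤ maximalIdeal R ^ μ) (hne : (pts c J μ).Nonempty)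
    (hδ : μ.factorial < deltaS c J μ) :
    betaS c' J'' μ + μ.factorial ≤ alphaS c J μ + betaS c J μ := by
  have hne' : (pts (c ∘ σ₁₂) J μ).Nonempty := (pts_comp_σ₁₂_nonempty_iff c J μ).mpr hne
  have hδ' : μ.factorial < deltaS (c ∘ σ₁₂) J μ := by rwa [deltaS_comp_σ₁₂]
  have key := zetaS_colon_add_le φ (chartTwo_h₁ φ h₂) (chartTwo_h₀ φ h₀) (chartTwo_h₂ φ h₁)
    (chartTwo_hgen hgen) hdim (chartTwo_hgen' hgen') hdim' hJμ hne' hδ'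
  rw [colon_comp_σ₁₂, zetaS_comp_σ₁₂, zetaS_comp_σ₁₂, epsS_comp_σ₁₂] at key
  omega

include h₂ h₀ h₁ hgen hdim hgen' hdim' in
/-- **Strict drop of `β` at `x′₁` when `α < 1`** (CoP1 Lemma 4.5 (2), the point `x′₁`;
CJS Lemma 12.2 (5)). [cite: CossartPiltant2008, Lemma 4.5 (2)] [cite: CossartJannsenSaito2020, Lemma 12.2 (5)] -/
theorem betaS_colon_two_lt (hJμ : J ≤ maximalIdeal R ^ μ) (hne : (pts c J μ).Nonempty)
    (hδ : μ.factorial < deltaS c J μ) (hα : alphaS c J μ < μ.factorial) :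
    betaS c' J'' μ < betaS c J μ := by
  have := betaS_colon_two_add_le φ h₂ h₀ h₁ hgen hdim hgen' hdim' hJμ hne hδ
  omega

include h₂ h₀ h₁ hgen hdim hgen' hdim' in
/-- The weak transform in the `u₂`-chart has Newton points of `y`-degree `< μ`. [folklore] -/
theorem pts_colon_two_nonempty (hJμ : J ≤ maximalIdeal R ^ μ) (hne : (pts c J μ).Nonempty)
    (hδ : μ.factorial < deltaS c J μ) : (pts c' J'' μ).Nonempty := by
  have hne' : (pts (c ∘ σ₁₂) J μ).Nonempty := (pts_comp_σ₁₂_nonempty_iff c J μ).mpr hne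
  have hδ' : μ.factorial < deltaS (c ∘ σ₁₂) J μ := by rwa [deltaS_comp_σ₁₂]
  have key := pts_colon_nonempty φ (chartTwo_h₁ φ h₂) (chartTwo_h₀ φ h₀) (chartTwo_h₂ φ h₁)
    (chartTwo_hgen hgen) hdim (chartTwo_hgen' hgen') hdim' hJμ hne' hδ'
  rw [colon_comp_σ₁₂] at key
  exact (pts_comp_σ₁₂_nonempty_iff c' _ μ).mp key

end ChartTwo

end Literature.AlgebraicGeometry.Resolution
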